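import Summits.CriticalPhenomena.SAWScalingLimit.Theorems.SAWTotalPositivityCriticalBubbleBoundKestenColumnMassLeOne
import Literature.Probability.RandomPlanarGeometry.SAWWordBridges
import HarnessLib

/-!
# Line `kesten-product-renewal-dictionary` (crux stmt-CriticalPhenomena-7117): stub H4 — the critical
bridge series diverges, `Σ_n b_n x_c^n = ∞` and `Σ_h u_h = ∞`

Proof file for the registered stub `bridgeSeries_eq_top_of_unbounded` of the line
`kesten-product-renewal-dictionary` for the crux `SAWTotalPositivity.CriticalBubbleBound`.

HYPOTHESIS (stub H3 of the line, Hammersley–Welsh): the word-model bridge generating function is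
unbounded below the critical fugacity, i.e. for every `M` there are `0 < x < x_c` and `N` with
`M ≤ Σ_{w bridge SAW word, |w| ≤ N} x^{|w|}`.

CONCLUSION (this file):
* (i) `Σ_n b_n x_c^n = ⊤` in `ℝ≥0∞`, where `b_n = Zd.bridgeCount 2 n` counts the `n`-step bridges of `ℤ²`
  (vertex functions). For `0 ≤ x ≤ x_c` the truncated word sum is at most `Σ_{n ≤ N} b_n x_c^n`
  (`x^n ≤ x_c^n`, the bridge words of length `n` inject into `Zd.bridges 2 n` by `traj`), and the
  truncated critical sums are bounded by the full `ℝ≥0∞` series; `M` being arbitrary, the series is `⊤`.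
* (ii) `Σ_h u_h = ⊤`, where `u_h = columnMass h = Σ_{W : span W = h} x_c^{|W|}` is Kesten's renewal
  density: every bridge has exactly one span `h ∈ ℕ`, so `Σ_h u_h = Σ_W x_c^{|W|} = Σ_n b_n x_c^n`
  (slicing `Bridge = Σ n, Zd.bridges 2 n` by length).

Meaning for the line: Kesten's critical renewal walk has infinitely many renewal levels in mass
(`Σ_h u_h = ∞`), so no decay exponent `b > 1` for `u_h` is available.

Sources: N. Madras, G. Slade, *The Self-Avoiding Walk* (1993), §1.2 and Definition 1.2.4 (bridges,
`b_n`), §3.1 (Hammersley–Welsh: the bridge generating function diverges at `z_c`), §4.2 (Kesten's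
renewal structure, `u_h`); H. Kesten, *On the number of self-avoiding walks*, J. Math. Phys. 4 (1963), §4.
-/

noncomputable section

open Literature.Probability.LatticeModels
open Literature.Probability.RandomPlanarGeometry Literature.Probability.RandomPlanarGeometry.SAW
open scoped ENNReal NNReal BigOperators
open Classical

namespace Summit.CriticalPhenomena.SAWScalingLimit.Theorems.CriticalBubbleBound.Kesten.HW

/-! ## Bridge words versus bridge vertex functions -/

/-- The self-avoiding bridge words of length `n` inject (by `traj`) into `Zd.bridges 2 n`:
`#{w ∈ sawWords n : IsBridgeW w} ≤ b_n`. [cite: MadrasSlade1993, Definition 1.2.4] -/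
theorem card_filter_isBridgeW_le (n : ℕ) :
    ((sawWords n).filter (fun w => IsBridgeW w)).card ≤ Zd.bridgeCount 2 n := by
  unfold Zd.bridgeCount
  refine Finset.card_le_card_of_injOn traj (fun w hw => ?_) ?_
  · rw [Finset.mem_coe, Finset.mem_filter] at hw
    obtain ⟨hw, hb⟩ := hw
    exact Finset.mem_coe.2 (traj_mem_bridges (mem_sawWords.1 hw).1 (mem_sawWords.1 hw).2 hb)
  · intro w hw w' hw' h
    rw [Finset.mem_coe, Finset.mem_filter] at hw hw'
    exact eq_of_traj_eq ((mem_sawWords.1 hw.1).1.trans (mem_sawWords.1 hw'.1).1.symm) h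

/-- For `0 ≤ x ≤ x_c`, the word-model bridge generating function truncated at length `N` is at most the
truncated critical bridge series `Σ_{n ≤ N} b_n x_c^n`. [cite: MadrasSlade1993, §1.2] -/
theorem bridgeWordSum_le_sum_range (x : ℝ) (hx0 : 0 ≤ x) (hx : x ≤ criticalFugacity) (N : ℕ) :
    ∑ w ∈ (Finset.range (N + 1)).biUnion (fun n => (sawWords n).filter (fun w => IsBridgeW w)),
        x ^ w.length ≤
      ∑ n ∈ Finset.range (N + 1), (Zd.bridgeCount 2 n : ℝ) * criticalFugacity ^ n := by
  have hxc : 0 ≤ criticalFugacity := hx0.trans hx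
  -- the sets of words of different lengths are disjoint
  have hdisj : Set.PairwiseDisjoint (↑(Finset.range (N + 1)) : Set ℕ)
      (fun n => (sawWords n).filter (fun w => IsBridgeW w)) := by
    intro m _ n _ hmn
    rw [Function.onFun, Finset.disjoint_left]
    intro w hwm hwn
    exact hmn ((mem_sawWords.1 (Finset.mem_filter.1 hwm).1).1.symm.trans
      (mem_sawWords.1 (Finset.mem_filter.1 hwn).1).1)
  rw [Finset.sum_biUnion hdisj]
  refine Finset.sum_le_sum fun n _ => ?_
  calc ∑ w ∈ (sawWords n).filter (fun w => IsBridgeW w), x ^ w.length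
      ≤ ∑ _w ∈ (sawWords n).filter (fun w => IsBridgeW w), criticalFugacity ^ n := by
        refine Finset.sum_le_sum fun w hw => ?_
        rw [(mem_sawWords.1 (Finset.mem_filter.1 hw).1).1]
        exact pow_le_pow_left₀ hx0 hx n
    _ = (((sawWords n).filter (fun w => IsBridgeW w)).card : ℝ) * criticalFugacity ^ n := by
        rw [Finset.sum_const, nsmul_eq_mul]
    _ ≤ (Zd.bridgeCount 2 n : ℝ) * criticalFugacity ^ n :=
        mul_le_mul_of_nonneg_right (Nat.cast_le.2 (card_filter_isBridgeW_le n)) (pow_nonneg hxc _)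

/-- The truncated critical bridge series, cast to `ℝ≥0∞`, is the partial sum of the `ℝ≥0∞` series
`Σ_n b_n x_c^n`. [folklore] -/
theorem ofReal_sum_range_bridgeCount (N : ℕ) :
    ENNReal.ofReal (∑ n ∈ Finset.range (N + 1), (Zd.bridgeCount 2 n : ℝ) * criticalFugacity ^ n) =
      ∑ n ∈ Finset.range (N + 1),
        (Zd.bridgeCount 2 n : ℝ≥0∞) * ENNReal.ofReal (criticalFugacity ^ n) := by
  have hxc : 0 ≤ criticalFugacity := StripMass.criticalFugacity_pos.le
  rw [ENNReal.ofReal_sum_of_nonneg fun n _ => mul_nonneg (Nat.cast_nonneg _) (pow_nonneg hxc _)]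
  refine Finset.sum_congr rfl fun n _ => ?_
  rw [ENNReal.ofReal_mul (Nat.cast_nonneg _), ENNReal.ofReal_natCast]

/-! ## (i) The critical bridge series diverges -/

/-- **`Σ_n b_n x_c^n = ∞`**: if the word-model bridge generating function is unbounded on `(0, x_c)`
(Hammersley–Welsh), then the critical bridge series of `ℤ²` is `⊤` in `ℝ≥0∞`.
[cite: MadrasSlade1993, §3.1] -/
theorem bridgeSeries_eq_top
    (hU : ∀ M : ℝ, ∃ x : ℝ, 0 < x ∧ x < criticalFugacity ∧ ∃ N : ℕ,
      M ≤ ∑ w ∈ (Finset.range (N + 1)).biUnion (fun n => (sawWords n).filter (fun w => IsBridgeW w)),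
        x ^ w.length) :
    (∑' n : ℕ, (Zd.bridgeCount 2 n : ℝ≥0∞) * ENNReal.ofReal (criticalFugacity ^ n)) = ⊤ := by
  refine ENNReal.eq_top_of_forall_nnreal_le fun r => ?_
  obtain ⟨x, hx0, hxc, N, hM⟩ := hU r
  calc (r : ℝ≥0∞) = ENNReal.ofReal (r : ℝ) := ENNReal.ofReal_coe_nnreal.symm
    _ ≤ ENNReal.ofReal
          (∑ n ∈ Finset.range (N + 1), (Zd.bridgeCount 2 n : ℝ) * criticalFugacity ^ n) :=
        ENNReal.ofReal_le_ofReal (hM.trans (bridgeWordSum_le_sum_range x hx0.le hxc.le N))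
    _ = ∑ n ∈ Finset.range (N + 1),
          (Zd.bridgeCount 2 n : ℝ≥0∞) * ENNReal.ofReal (criticalFugacity ^ n) :=
        ofReal_sum_range_bridgeCount N
    _ ≤ ∑' n : ℕ, (Zd.bridgeCount 2 n : ℝ≥0∞) * ENNReal.ofReal (criticalFugacity ^ n) :=
        ENNReal.sum_le_tsum _

/-! ## (ii) The renewal density is not summable: `Σ_h u_h = Σ_W x_c^{|W|} = Σ_n b_n x_c^n` -/

/-- **`Σ_h u_h = Σ_W x_c^{|W|}`**: every bridge has exactly one span `h ∈ ℕ` (`span W ≥ 0`), so summing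
the renewal density over all levels gives the total critical bridge mass. [cite: MadrasSlade1993, §4.2] -/
theorem tsum_columnMass_eq_tsum_mass : (∑' h : ℕ, columnMass h) = ∑' W : Bridge, W.mass := by
  unfold columnMass
  rw [ENNReal.tsum_comm]
  refine tsum_congr fun W => ?_
  have hs : W.span = ((W.span.toNat : ℕ) : ℤ) := (Int.toNat_of_nonneg W.span_nonneg).symm
  rw [tsum_eq_single W.span.toNat]
  · rw [if_pos hs]
  · intro h hne
    rw [if_neg]
    intro hh
    apply hne
    have hcast : ((h : ℕ) : ℤ) = ((W.span.toNat : ℕ) : ℤ) := hh.symm.trans hs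
    exact_mod_cast hcast

/-- **`Σ_W x_c^{|W|} = Σ_n b_n x_c^n`**: slice the bridges `Bridge = Σ n, Zd.bridges 2 n` by length;
the `n`-slice is the finite sum of `b_n` copies of `x_c^n`. [cite: MadrasSlade1993, §1.2] -/
theorem tsum_mass_eq_bridgeSeries :
    (∑' W : Bridge, W.mass) =
      ∑' n : ℕ, (Zd.bridgeCount 2 n : ℝ≥0∞) * ENNReal.ofReal (criticalFugacity ^ n) := by
  rw [ENNReal.tsum_sigma']
  refine tsum_congr fun n => ?_
  rw [tsum_fintype]
  show ∑ _b : ↥(Zd.bridges 2 n), ENNReal.ofReal (criticalFugacity ^ n) = _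
  rw [Finset.sum_const, Finset.card_univ, Fintype.card_coe, nsmul_eq_mul]
  rfl

/-! ## The registered stub -/

/-- **Stub H4 of the line `kesten-product-renewal-dictionary`** (registered signature, verbatim): from the
unboundedness below `x_c` of the word-model bridge generating function (stub H3, Hammersley–Welsh) it
follows that (i) the critical bridge series `Σ_n b_n x_c^n` of `ℤ²` is infinite and (ii) Kesten's renewal
density is not summable, `Σ_h u_h = ∞` (every bridge has exactly one span, so `Σ_h u_h = Σ_n b_n x_c^n`).
[cite: MadrasSlade1993, §3.1, §4.2] -/
theorem bridgeSeries_eq_top_of_unbounded : (∀ M : ℝ, ∃ x : ℝ, 0 < x ∧ x < criticalFugacity ∧ ∃ N : ℕ, M ≤ ∑ w ∈ (Finset.range (N + 1)).biUnion (fun n => (sawWords n).filter (fun w => IsBridgeW w)), x ^ w.length) → (∑' n : ℕ, (Zd.bridgeCount 2 n : ℝ≥0∞) * ENNReal.ofReal (criticalFugacity ^ n)) = ⊤ ∧ (∑' h : ℕ, columnMass h) = ⊤ := by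
  intro hU
  have htop := bridgeSeries_eq_top hU
  refine ⟨htop, ?_⟩
  rw [tsum_columnMass_eq_tsum_mass, tsum_mass_eq_bridgeSeries]
  exact htop

end Summit.CriticalPhenomena.SAWScalingLimit.Theorems.CriticalBubbleBound.Kesten.HW

end
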